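import Mathlib
import Literature.Combinatorics.Additive.Pollard
import Summits.MatrixMultiplication.MatrixMultiplication.Theses.AbelianSTPPCensusVP

/-!
# Route AbelianSTPPCensusVP — BC5 witness (first rung) for crux `GrynkiewiczWeak` (stmt-MatrixMultiplication-19190)

The prime-cyclic case of the crux AS TYPED, PROVED from Pollard's theorem (tree, kernel:
`Literature.Combinatorics.Additive.pollard`, p409392): for `X, Y ⊆ ℤ/pℤ` and `2 ≤ t ≤ min(|X|,|Y|)`, either the
Pollard-type inequalities of the first disjunct hold (when `|X| + |Y| − t ≤ p`, since `t·(|X|+|Y|−t) = t(|X|+|Y|) − t²`),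
or `|X| + |Y| ≥ p + t + 1` and then EVERY element of `ℤ/pℤ` has `≥ |X| + |Y| − p ≥ t` representations (pigeonhole), so the
structural alternative holds with `X′ = X`, `Y′ = Y`, `ℓ = 0`.  This is a decided instance of the crux in a regime where the
leaf `NoAbelianSTPPHost_250_337` is not known (it says nothing about composite orders 128–337) and it exercises the route's
lever (popular-sum lower bounds ⇒ packing rules).  Cell mm-stpp, planner gen 7; farm-checked; to be landed by a proving seat.
[cite: Pollard1974, Thm 1] [cite: Nathanson1996, Thm 2.4]
-/

namespace Summit.MatrixMultiplication.MatrixMultiplication.Theorems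

open Finset Literature.Combinatorics.Additive

set_option linter.dupNamespace false -- `MatrixMultiplication.MatrixMultiplication` (summit = problem, D-0017)

namespace AbelianSTPPCensusVP

/-- Pigeonhole in `ℤ/pℤ`: `r_{X,Y}(w) + p ≥ |X| + |Y|`. -/
theorem card_add_card_le_rep_add {p : ℕ} [Fact p.Prime] (X Y : Finset (ZMod p)) (w : ZMod p) :
    X.card + Y.card ≤ Pollard.rep X Y w + p := by
  rw [Pollard.rep_eq_card_filter_right]
  have hsplit := card_filter_add_card_filter_not (s := Y) (fun y => w - y ∈ X)
  have hneg : (Y.filter (fun y => ¬ (w - y ∈ X))).card ≤ (univ \ X).card := by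
    refine card_le_card_of_injOn (fun y => w - y) ?_ ?_
    · intro y hy
      simp only [coe_filter, Set.mem_setOf_eq] at hy
      simp [hy.2]
    · intro y₁ _ y₂ _ h
      simpa using h
  have huniv : (univ \ X).card = p - X.card := by
    rw [card_univ_sdiff, ZMod.card p]
  have hXp : X.card ≤ p := by simpa [ZMod.card p] using card_le_univ X
  omega

/-- **First rung of crux `GrynkiewiczWeak`: the prime-cyclic case, from Pollard's theorem (no sorry).** -/
theorem GrynkiewiczWeak_rung_prime {p : ℕ} [Fact p.Prime] (X Y : Finset (ZMod p)) (t : ℕ)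
    (ht : 2 ≤ t) (htX : t ≤ X.card) (htY : t ≤ Y.card) :
    (((3 ≤ t → t * (X.card + Y.card) + 1 ≤ Nt X Y t + 2 * t ^ 2) ∧
        (t = 2 → 2 * (X.card + Y.card) ≤ Nt X Y 2 + 4)) ∨
      ∃ X' ⊆ X, ∃ Y' ⊆ Y, (X \ X').card + (Y \ Y').card + 1 ≤ t ∧
        ∀ x ∈ X', ∀ y ∈ Y', t ≤ repCount X Y (x + y)) := by
  have hNt : ∀ s, Nt X Y s = ∑ w, min s (Pollard.rep X Y w) := fun s => rfl
  by_cases hbig : p + t < X.card + Y.card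
  · -- every element is `t`-popular: the alternative with `X' = X`, `Y' = Y`, `ℓ = 0`
    refine Or.inr ⟨X, subset_refl X, Y, subset_refl Y, by simp; omega, fun x _ y _ => ?_⟩
    have hpig := card_add_card_le_rep_add X Y (x + y)
    change t ≤ Pollard.rep X Y (x + y)
    omega
  · -- Pollard's bound `t (|X| + |Y| - t) ≤ N_t` gives the first disjunct
    refine Or.inl ?_
    have hP := pollard X Y (t := t) (by omega) htX htY
    have hmin : min p (X.card + Y.card - t) = X.card + Y.card - t := min_eq_right (by omega)
    rw [hmin, ← hNt] at hP
    set S := X.card + Y.card with hS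
    have htS : t ≤ S := by omega
    have key : t * (S - t) + t * t = t * S := by
      rw [← Nat.mul_add, Nat.sub_add_cancel htS]
    have htt : 1 ≤ t * t := Nat.one_le_iff_ne_zero.mpr (by positivity)
    refine ⟨fun _ => ?_, fun h2 => ?_⟩
    · have hsq : t ^ 2 = t * t := sq t
      rw [hsq]
      linarith [hP, key, htt]
    · subst h2
      have hP2 : 2 * (S - 2) ≤ Nt X Y 2 := hP
      omega

end AbelianSTPPCensusVP

end Summit.MatrixMultiplication.MatrixMultiplication.Theorems
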